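import Summits.BirchSwinnertonDyer.Rank1Residual.X1.GeneratorCountAnomalous
import HarnessLib

/-!
# Route M's generator COUNT, V: the SECOND generator at `p` — `GeneratorCountGE W p (#S + 2)` when
# `E(ℚ_p)` has a point of order `p` (pair counting with a squared factor at `v_p`)
# (cell `b2b-bsdres`, unit `b2b-bsdres-eisenstein-p1`, gen 15; FILE 5)

HONEST FRAMING (run/shared/lean/b2b/bsd-rank1-residual/, verbatim in every file): the goal of the
cell is to DELETE the COMBINATION-SHAPED residual classes of the Birch–Swinnerton-Dyer formula for
ALL analytic-rank `≤ 1` elliptic curves over `ℚ` — "full BSD formula for every rank `≤ 1` curve in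
class `C`" assembled STRICTLY from published theorems — so that the rank-`≤ 1` remainder becomes
exactly the CONSTRUCTION-SHAPED classes, which are TYPED (missing-input `Prop`s), NOT attempted.
This is not "finishing BSD". Sub-cell `b2b-bsdres-eisenstein-p1` (CLASS-OWNERS row "X1 (r = 0)"):
research route; NO CLAIM BEYOND STATED CLASSES; nothing here changes a label; nothing is booked.
THEOREMS ONLY — no definition, no named fact, no typed input introduced; named fact consumed:
Poitou–Tate duality for Selmer structures (`inv` / `hPT`), PUBLISHED; the local statement `hloc` of
FILE 3 §1 stays an explicit hypothesis.

## What

Route T's layer-`0` count is `B₀ = t₀ + a − 2δ` with `a = 2` exactly when `E(ℚ_p)[p] ≠ 0`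
(X1R0-GAPMAP §14.1 (d): `M/N_∞ ≅ (ℤ/p)²`); FILE 3 gave `t₀ + 1`. Here:

* §1 `finite_and_pow_le_card_selmerGroup_of_kummer_le_pow` (any number field): n1011's pair count
  `Additive.finite_and_pow_le_card_selmerGroup_of_kummer_le` with PER-PLACE EXPONENTS —
  `p^{e_v} · #𝓚_v ≤ #𝓖_v` on `T₀` ⟹ `p^{Σ e_v} ≤ #H¹_𝓖(K, E[p])` (same proof: Wiles/DDT 2.19 product
  formula `GaloisImage.card_selmerGroup_pair`, self-duality `#H¹_𝓚 = #H¹_{𝓚*}`).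
* §2 `sq_mul_natCard_kummer_le_natCard_top`: at `v ∋ p`, a `ℚ_v`-point of order `p` gives
  `p² · #𝓚_v ≤ #H¹(ℚ_v, E[p])` (`#𝓚_v = t·p`, `#H¹ = (t·p)²`, `t = #E(ℚ_v)[p] ≥ p`; Euler–Poincaré is a
  tree theorem).
* §3 `generatorCountGE_of_dvd_localTamagawaNumber_atP_two`: `p` odd, `p ∤ #E(ℚ)_tors`, `hloc`,
  `p ∣ c_v` on `S`, a point of order `p` in `E(ℚ_p)` ⟹ **`GeneratorCountGE W p (#S + 2)`**.
  Census reach (X1R0-GAPMAP §24, `routeM/routeM15tama.py`): with `a = 2` available the count-discharged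
  M₀ closures go from 69 to 177 of 482 (modulo `hloc`).

References: [GreenbergLNM1716] §3 Lemma 3.4 (p. 89), §5 pp. 114–118, p. 137; [MilneADT2006] Ch. I
Thm. 2.8, Lemma 3.3, Thm. 4.10; [DDT1997] Thm. 2.19; X1R0-GAPMAP §14.1 (d), §24.
-/

noncomputable section

open scoped Classical

open Function Field NumberField IsDedekindDomain WeierstrassCurve
  Literature.NumberTheory.EllipticCurves Literature.NumberTheory.GaloisRepresentations
  Literature.NumberTheory.GaloisCohomology Summit.BirchSwinnertonDyer.Rank1Residual.GaloisImage
  Summit.BirchSwinnertonDyer.Rank1Residual.X1.GeneratorCountAnomalous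
open Literature.NumberTheory.GaloisRepresentations.DiscreteGaloisModule (SelmerStructure unramifiedSubgroup)

set_option autoImplicit false

universe u

namespace Summit.BirchSwinnertonDyer.Rank1Residual.X1.GeneratorCountAnomalousTwo

/-! ## §1. Pair counting against the Kummer structure with per-place exponents -/

section Count

variable {K : Type u} [Field K] [NumberField K] (W : WeierstrassCurve K) [W.IsElliptic] (p : ℕ)
  [hp : Fact p.Prime]

/-- **Pair counting against the Kummer structure, with exponents.** As n1011's
`Additive.finite_and_pow_le_card_selmerGroup_of_kummer_le` (`p` odd, `𝓚 ≤ 𝓖` agreeing at `∞`, both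
unramified outside `S(T)`), but with `#𝓖_v ≥ p^{e_v} · #𝓚_v` at every `v ∈ T₀ ⊆ T`: then
`H¹_𝓖(K, E[p])` is finite and `#H¹_𝓖(K, E[p]) ≥ p^{Σ_{v ∈ T₀} e_v}`. [folklore] -/
theorem finite_and_pow_le_card_selmerGroup_of_kummer_le_pow (hodd : p ≠ 2)
    (inv : LocalInvariants K p) (hperf : inv.IsPerfect) (hsum : inv.SumLocalTermEqZero)
    (hcompl : inv.SelmerComplement)
    (hEP : ∀ v : HeightOneSpectrum (𝓞 K), localEulerPoincareCharacteristic (v.adicCompletion K))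
    (T : Finset (HeightOneSpectrum (𝓞 K)))
    (hS : ∀ v ∉ T, ((p : ℕ) : 𝓞 K) ∉ v.asIdeal ∧
      GaloisRep.IsUnramifiedAt v (W.torsionGaloisModule (p : ℤ)))
    (h𝓚 : (W.kummerSelmerStructure (p : ℤ)).IsUnramifiedOutside (finSupport T))
    {𝓖 : SelmerStructure (W.torsionGaloisModule (p : ℤ))} (hle : W.kummerSelmerStructure (p : ℤ) ≤ 𝓖)
    (h𝓖 : 𝓖.IsUnramifiedOutside (finSupport T))
    (hinf : ∀ w : InfinitePlace K, W.kummerSelmerStructure (p : ℤ) (Sum.inl w) = 𝓖 (Sum.inl w))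
    (T₀ : Finset (HeightOneSpectrum (𝓞 K))) (hT₀ : T₀ ⊆ T) (e : HeightOneSpectrum (𝓞 K) → ℕ)
    (hbig : ∀ v ∈ T₀, p ^ e v * Nat.card (W.kummerSelmerStructure (p : ℤ) (Sum.inr v)) ≤
      Nat.card (𝓖 (Sum.inr v))) :
    Finite 𝓖.selmerGroup ∧ p ^ (∑ v ∈ T₀, e v) ≤ Nat.card 𝓖.selmerGroup := by
  haveI : NeZero p := ⟨hp.out.ne_zero⟩
  haveI : Finite (geomTorsion W (p : ℤ)) := finite_geomTorsion_of_neZero W p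
  -- `Sel⁽ᵖ⁾(E/K) = H¹_𝓚(K, E[p])` is finite
  haveI hfinK : Finite (W.kummerSelmerStructure (p : ℤ)).selmerGroup := by
    rw [← selmerGroup_eq_selmerGroup_kummerSelmerStructure]
    exact finite_selmerGroup_holds W (by exact_mod_cast hp.out.ne_zero)
  -- the Weil pairing and the self-duality count `#H¹_𝓚 = #H¹_{𝓚*}`
  obtain ⟨e', hμ, hadd₁, hadd₂, halt, hnondeg, hgal⟩ :=
    exists_weilPairing_holds W p hp.out.two_le (Nat.cast_ne_zero.mpr hp.out.ne_zero)
  have hinv : ∀ v : HeightOneSpectrum (𝓞 K), Injective (inv (Sum.inr v)) :=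
    fun v ↦ (hperf v).1.injective
  have hself := natCard_selmerGroup_kummer_eq_dual W p e' hμ hadd₁ hadd₂ hgal halt hnondeg
    hp.out.isPrimePow (hp.out.odd_of_ne_two hodd) inv hinv hEP
  -- pair counting
  have hM : ∀ m : geomTorsion W (p : ℤ), p • m = 0 := fun m ↦ Subtype.ext <| by
    rw [AddSubgroupClass.coe_nsmul, ZeroMemClass.coe_zero]
    exact AddSubgroup.torsionBy.nsmul_iff.mp m.2
  have hpair := card_selmerGroup_pair (W.torsionGaloisModule (p : ℤ)) T inv hperf hsum hcompl
    hM hS hle h𝓚 h𝓖 hinf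
  rw [← hself] at hpair
  -- positivity of the factors
  have ha : 0 < Nat.card (W.kummerSelmerStructure (p : ℤ)).selmerGroup := Nat.card_pos
  haveI : Finite (inv.dualSelmerStructure (W.torsionGaloisModule (p : ℤ))
      (W.kummerSelmerStructure (p : ℤ))).selmerGroup :=
    Nat.finite_of_card_ne_zero (hself ▸ ha.ne')
  haveI : Finite (inv.dualSelmerStructure (W.torsionGaloisModule (p : ℤ)) 𝓖).selmerGroup :=
    Finite.of_injective _ (AddSubgroup.inclusion_injective
      (LocalInvariants.selmerGroup_dualSelmerStructure_anti inv (W.torsionGaloisModule (p : ℤ)) hle))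
  have hGd : 0 < Nat.card (inv.dualSelmerStructure (W.torsionGaloisModule (p : ℤ)) 𝓖).selmerGroup :=
    Nat.card_pos
  have hlocfin : ∀ v : HeightOneSpectrum (𝓞 K),
      Finite (galoisCohomology ((W.torsionGaloisModule (p : ℤ)).toLocal (Sum.inr v)) 1) :=
    fun v ↦ finite_galoisCohomology_one_toLocal _ v
  have hPK : 0 < ∏ v ∈ T, Nat.card (W.kummerSelmerStructure (p : ℤ) (Sum.inr v)) := by
    refine Finset.prod_pos fun v _ ↦ ?_
    haveI := hlocfin v
    exact Nat.card_pos
  -- `∏_T #𝓖_v ≥ p^{Σ e_v} · ∏_T #𝓚_v`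
  have hprod : p ^ (∑ v ∈ T₀, e v) *
      ∏ v ∈ T, Nat.card (W.kummerSelmerStructure (p : ℤ) (Sum.inr v)) ≤
      ∏ v ∈ T, Nat.card (𝓖 (Sum.inr v)) := by
    have hc : ∏ v ∈ T, (if v ∈ T₀ then p ^ e v else 1) = p ^ (∑ v ∈ T₀, e v) := by
      rw [Finset.prod_ite_mem, Finset.inter_eq_right.mpr hT₀, Finset.prod_pow_eq_pow_sum]
    rw [← hc, ← Finset.prod_mul_distrib]
    refine Finset.prod_le_prod (fun v _ ↦ Nat.zero_le _) fun v _ ↦ ?_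
    haveI := hlocfin v
    split_ifs with hv
    · exact hbig v hv
    · rw [one_mul]
      exact AddSubgroup.card_le_of_le (hle (Sum.inr v))
  -- conclude
  have hkey : p ^ (∑ v ∈ T₀, e v) *
      ∏ v ∈ T, Nat.card (W.kummerSelmerStructure (p : ℤ) (Sum.inr v)) ≤
      Nat.card 𝓖.selmerGroup *
        ∏ v ∈ T, Nat.card (W.kummerSelmerStructure (p : ℤ) (Sum.inr v)) := by
    have h1 : Nat.card 𝓖.selmerGroup *
        ∏ v ∈ T, Nat.card (W.kummerSelmerStructure (p : ℤ) (Sum.inr v)) =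
        Nat.card (inv.dualSelmerStructure (W.torsionGaloisModule (p : ℤ)) 𝓖).selmerGroup *
          ∏ v ∈ T, Nat.card (𝓖 (Sum.inr v)) := by
      refine Nat.eq_of_mul_eq_mul_left ha ?_
      calc Nat.card (W.kummerSelmerStructure (p : ℤ)).selmerGroup * (Nat.card 𝓖.selmerGroup *
              ∏ v ∈ T, Nat.card (W.kummerSelmerStructure (p : ℤ) (Sum.inr v)))
          = Nat.card 𝓖.selmerGroup * Nat.card (W.kummerSelmerStructure (p : ℤ)).selmerGroup *
              ∏ v ∈ T, Nat.card (W.kummerSelmerStructure (p : ℤ) (Sum.inr v)) := by ring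
        _ = _ := hpair
        _ = _ := by ring
    rw [h1]
    calc p ^ (∑ v ∈ T₀, e v) * ∏ v ∈ T, Nat.card (W.kummerSelmerStructure (p : ℤ) (Sum.inr v))
        ≤ ∏ v ∈ T, Nat.card (𝓖 (Sum.inr v)) := hprod
      _ ≤ _ := Nat.le_mul_of_pos_left _ hGd
  have hG : p ^ (∑ v ∈ T₀, e v) ≤ Nat.card 𝓖.selmerGroup := Nat.le_of_mul_le_mul_right hkey hPK
  exact ⟨Nat.finite_of_card_ne_zero (Nat.pos_iff_ne_zero.mp
    (lt_of_lt_of_le (pow_pos hp.out.pos _) hG)), hG⟩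

end Count

/-! ## §2. At `v ∋ p` with a `ℚ_v`-rational point of order `p`: `p² · #𝓚_v ≤ #H¹(ℚ_v, E[p])` -/

section AtP

variable {W : WeierstrassCurve ℚ} [W.IsElliptic] {p : ℕ} [hp : Fact p.Prime]

/-- **A second factor `p` at `v ∋ p` from a rational point of order `p`**: if `E(ℚ_v)` has a point of
order `p` then `#E(ℚ_v)[p] ≥ p`, so `#H¹(ℚ_v, E[p]) = (#E(ℚ_v)[p]·p)² ≥ p² · (#E(ℚ_v)[p]·p) = p²·#𝓚_v`
(tree: Euler–Poincaré count `GaloisImage.natCard_galoisCohomology_toLocal_torsion_eq_sq`, Kummer count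
`natCard_kummerSelmerStructure_inr`). This is `a = 2` of X1R0-GAPMAP §14.1 (d).
[cite: MilneADT2006, Ch. I Thm. 2.8 and Lemma 3.3] [cite: GreenbergLNM1716, §3 Lemma 3.4 (p. 89)] -/
theorem sq_mul_natCard_kummer_le_natCard_top {v : HeightOneSpectrum (𝓞 ℚ)}
    (hv : ((p : ℕ) : 𝓞 ℚ) ∈ v.asIdeal)
    (hPt : ∃ P : (W.baseChange (v.adicCompletion ℚ)).toAffine.Point, P ≠ 0 ∧ p • P = 0) :
    p ^ 2 * Nat.card (W.kummerSelmerStructure (p : ℤ) (Sum.inr v)) ≤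
      Nat.card (⊤ : AddSubgroup
        (galoisCohomology ((W.torsionGaloisModule (p : ℤ)).toLocal (Sum.inr v : Place ℚ)) 1)) := by
  rw [AddSubgroup.card_top, natCard_galoisCohomology_toLocal_torsion_eq_sq W p v,
    W.natCard_kummerSelmerStructure_inr v hp.out.ne_zero,
    natCard_quot_adicCompletionIntegers_of_prime_mem p hv]
  set G := (nsmulAddMonoidHom p : (W.baseChange (v.adicCompletion ℚ)).toAffine.Point →+ _).ker
  haveI : Finite G := W.finite_ker_nsmul_adicCompletion v hp.out.ne_zero
  -- `#E(ℚ_v)[p] ≥ p`: a nonzero element of the `p`-torsion kernel has order `p ∣ #G`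
  obtain ⟨P, hP0, hpP⟩ := hPt
  have hPG : P ∈ G := by rw [AddMonoidHom.mem_ker, nsmulAddMonoidHom_apply]; exact hpP
  have hord : addOrderOf (⟨P, hPG⟩ : G) = p := by
    have hpP' : p • (⟨P, hPG⟩ : G) = 0 := Subtype.ext hpP
    refine ((hp.out.eq_one_or_self_of_dvd _ (addOrderOf_dvd_of_nsmul_eq_zero hpP')).resolve_left
      fun h ↦ hP0 ?_)
    exact congrArg Subtype.val (AddMonoid.addOrderOf_eq_one_iff.mp h)
  have hpt : p ≤ Nat.card G :=
    Nat.le_of_dvd Nat.card_pos (hord ▸ addOrderOf_dvd_natCard (⟨P, hPG⟩ : G))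
  set t := Nat.card G with ht
  calc p ^ 2 * (t * p) = (p * p) * (t * p) := by rw [sq]
    _ ≤ (t * p) * (t * p) := Nat.mul_le_mul_right _ (Nat.mul_le_mul_right _ hpt)
    _ = (t * p) ^ 2 := (sq _).symm

/-- **The relaxed-Kummer count with `v_p` at local condition `⊤`, squared factor**: as FILE 3's
`exists_addSubgroup_relaxedKummer_atP` but with `#S ≥ p^{#T₀ + 2}` when `E(ℚ_p)` has a point of order
`p` (§1 with exponent `2` at `v_p`, §2). [cite: GreenbergLNM1716, §3 Lemma 3.4, §5 pp. 114–118]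
[cite: MilneADT2006, Ch. I Thm. 2.8, Thm. 4.10] -/
theorem exists_addSubgroup_relaxedKummer_atP_two (hodd : p ≠ 2)
    (inv : LocalInvariants ℚ p) (hperf : inv.IsPerfect) (hsum : inv.SumLocalTermEqZero)
    (hcompl : inv.SelmerComplement)
    (T₀ : Finset (HeightOneSpectrum (𝓞 ℚ))) (hT₀p : ∀ v ∈ T₀, ((p : ℕ) : 𝓞 ℚ) ∉ v.asIdeal)
    (hwit : ∀ v ∈ T₀, ∃ u ∈ unramifiedSubgroup
        ((W.torsionGaloisModule (p : ℤ)).restrictField (v.adicCompletion ℚ)) 1,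
      u ∉ W.kummerLocalConditionAt (p : ℤ) (v.adicCompletion ℚ))
    (vp : HeightOneSpectrum (𝓞 ℚ)) (hvp : ((p : ℕ) : 𝓞 ℚ) ∈ vp.asIdeal)
    (hPt : ∃ P : (W.baseChange (vp.adicCompletion ℚ)).toAffine.Point, P ≠ 0 ∧ p • P = 0) :
    ∃ S : AddSubgroup (galH1Torsion W (p : ℤ)), Finite S ∧ p ^ (T₀.card + 2) ≤ Nat.card S ∧
      ∀ y ∈ S,
        (∀ v ∉ (↑(insert vp T₀) : Set (HeightOneSpectrum (𝓞 ℚ))),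
            y ∈ selmerLocalKer W (v.adicCompletion ℚ) (p : ℤ)) ∧
        (∀ w : InfinitePlace ℚ, y ∈ selmerLocalKer W w.Completion (p : ℤ)) ∧
        ∀ v ∈ T₀, galoisCohomology.res (W.torsionGaloisModule (p : ℤ)) (v.adicCompletion ℚ) 1 y ∈
          unramifiedSubgroup ((W.torsionGaloisModule (p : ℤ)).restrictField (v.adicCompletion ℚ)) 1 ⊔
            W.kummerLocalConditionAt (p : ℤ) (v.adicCompletion ℚ) := by
  haveI : NeZero p := ⟨hp.out.ne_zero⟩
  haveI : Finite (geomTorsion W (p : ℤ)) := finite_geomTorsion_of_neZero W p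
  have hEP := EP.forall_localEulerPoincareCharacteristic_adicCompletion ℚ
  have hvpT₀ : vp ∉ T₀ := fun h ↦ hT₀p vp h hvp
  have hbadfin : {v : HeightOneSpectrum (𝓞 ℚ) | ¬ W.HasGoodReductionAt v}.Finite := by
    have h := W.eventually_hasGoodReductionAt
    rwa [Filter.eventually_cofinite] at h
  have hp0 : (Ideal.span {((p : ℕ) : 𝓞 ℚ)} : Ideal (𝓞 ℚ)) ≠ 0 := by
    rw [Ne, Ideal.zero_eq_bot, Ideal.span_singleton_eq_bot]
    exact_mod_cast hp.out.ne_zero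
  have hpfin : {v : HeightOneSpectrum (𝓞 ℚ) | ((p : ℕ) : 𝓞 ℚ) ∈ v.asIdeal}.Finite := by
    refine (Ideal.finite_factors hp0).subset fun v hv ↦ ?_
    exact (Ideal.dvd_span_singleton).mpr hv
  set T₁ : Finset (HeightOneSpectrum (𝓞 ℚ)) := insert vp T₀ with hT₁
  obtain ⟨T, hT₁T, hTp, hTbad⟩ : ∃ T : Finset (HeightOneSpectrum (𝓞 ℚ)), T₁ ⊆ T ∧
      (∀ v, ((p : ℕ) : 𝓞 ℚ) ∈ v.asIdeal → v ∈ T) ∧ ∀ v, ¬ W.HasGoodReductionAt v → v ∈ T :=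
    ⟨T₁ ∪ (hbadfin.toFinset ∪ hpfin.toFinset), Finset.subset_union_left,
      fun v hv ↦ Finset.mem_union_right _ (Finset.mem_union_right _ (hpfin.mem_toFinset.mpr hv)),
      fun v hv ↦ Finset.mem_union_right _ (Finset.mem_union_left _ (hbadfin.mem_toFinset.mpr hv))⟩
  have hS : ∀ v ∉ T, ((p : ℕ) : 𝓞 ℚ) ∉ v.asIdeal ∧
      GaloisRep.IsUnramifiedAt v (W.torsionGaloisModule (p : ℤ)) := fun v hv ↦ by
    have hpv : ((p : ℕ) : 𝓞 ℚ) ∉ v.asIdeal := fun h ↦ hv (hTp v h)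
    have hgood : W.HasGoodReductionAt v := by_contra fun h ↦ hv (hTbad v h)
    exact ⟨hpv, X11b.AcSelmer.isUnramifiedAt_torsionGaloisModule W hgood
      (by rw [Int.cast_natCast]; exact hpv)⟩
  have hfs_p : ∀ v : HeightOneSpectrum (𝓞 ℚ), ((p : ℕ) : 𝓞 ℚ) ∈ v.asIdeal →
      (Sum.inr v : Place ℚ) ∈ finSupport T := fun v hv ↦ (inr_mem_finSupport_iff T v).mpr (hTp v hv)
  have hfs_bad : ∀ v : HeightOneSpectrum (𝓞 ℚ), ¬ W.HasGoodReductionAt v →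
      (Sum.inr v : Place ℚ) ∈ finSupport T := fun v hv ↦ (inr_mem_finSupport_iff T v).mpr (hTbad v hv)
  have h𝓚 : (W.kummerSelmerStructure (p : ℤ)).IsUnramifiedOutside (finSupport T) := by
    have h1 := X11b.KummerDuality.kummerSelmerStructure_isUnramifiedOutside W p 1
      (finSupport T) (inl_mem_finSupport T) hfs_p hfs_bad
    rwa [pow_one] at h1
  obtain ⟨𝓖, h𝓖inl, h𝓖vp, h𝓖T₀, h𝓖off⟩ : ∃ 𝓖 : SelmerStructure (W.torsionGaloisModule (p : ℤ)),
      (∀ w : InfinitePlace ℚ, 𝓖 (Sum.inl w) = W.kummerSelmerStructure (p : ℤ) (Sum.inl w)) ∧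
      𝓖 (Sum.inr vp) = ⊤ ∧
      (∀ v ∈ T₀, 𝓖 (Sum.inr v) =
        unramifiedSubgroup (GaloisRep.toLocal v (W.torsionGaloisModule (p : ℤ))) 1 ⊔
          W.kummerSelmerStructure (p : ℤ) (Sum.inr v)) ∧
      (∀ v ∉ T₁, 𝓖 (Sum.inr v) = W.kummerSelmerStructure (p : ℤ) (Sum.inr v)) := by
    refine ⟨fun w ↦ match w with
      | Sum.inl w => W.kummerSelmerStructure (p : ℤ) (Sum.inl w)
      | Sum.inr v => if v = vp then ⊤ else if v ∈ T₀ then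
          unramifiedSubgroup (GaloisRep.toLocal v (W.torsionGaloisModule (p : ℤ))) 1 ⊔
            W.kummerSelmerStructure (p : ℤ) (Sum.inr v)
        else W.kummerSelmerStructure (p : ℤ) (Sum.inr v),
      fun _ ↦ rfl, if_pos rfl, fun v hv ↦ ?_, fun v hv ↦ ?_⟩
    · have hne : v ≠ vp := fun h ↦ hvpT₀ (h ▸ hv)
      exact (if_neg hne).trans (if_pos hv)
    · have hne : v ≠ vp := fun h ↦ hv (h ▸ Finset.mem_insert_self vp T₀)
      have hv' : v ∉ T₀ := fun h ↦ hv (Finset.mem_insert_of_mem h)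
      exact (if_neg hne).trans (if_neg hv')
  have hle : W.kummerSelmerStructure (p : ℤ) ≤ 𝓖 := by
    rintro (w | v)
    · rw [h𝓖inl w]
    · by_cases hv : v = vp
      · subst hv; rw [h𝓖vp]; exact le_top
      by_cases hv' : v ∈ T₀
      · rw [h𝓖T₀ v hv']; exact le_sup_right
      · rw [h𝓖off v (by
          rw [Finset.mem_insert, not_or]; exact ⟨hv, hv'⟩)]
  have h𝓖ur : 𝓖.IsUnramifiedOutside (finSupport T) := by
    refine ⟨inl_mem_finSupport T, fun v hv ↦ ?_⟩
    have hvT : v ∉ T := fun h ↦ hv ((inr_mem_finSupport_iff T v).mpr h)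
    rw [h𝓖off v fun h ↦ hvT (hT₁T h)]
    exact h𝓚.2 v hv
  -- exponents: `2` at `vp`, `1` on `T₀`
  have hbig : ∀ v ∈ T₁, p ^ (if v = vp then 2 else 1) *
      Nat.card (W.kummerSelmerStructure (p : ℤ) (Sum.inr v)) ≤ Nat.card (𝓖 (Sum.inr v)) := fun v hv ↦ by
    rcases Finset.mem_insert.mp hv with rfl | hv
    · rw [if_pos rfl, h𝓖vp]
      exact sq_mul_natCard_kummer_le_natCard_top hvp hPt
    · have hne : v ≠ vp := fun h ↦ hvpT₀ (h ▸ hv)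
      rw [if_neg hne, pow_one]
      haveI := finite_galoisCohomology_one_toLocal (W.torsionGaloisModule (p : ℤ)) v
      obtain ⟨u, hu, huK⟩ := hwit v hv
      refine Additive.mul_card_le_card_of_lt
        (Additive.smul_galoisCohomology_toLocal_torsion_eq_zero W p v) ?_
      rw [h𝓖T₀ v hv]
      exact right_lt_sup.mpr fun h ↦ huK (h hu)
  obtain ⟨hfin, hcard⟩ := finite_and_pow_le_card_selmerGroup_of_kummer_le_pow W p hodd inv hperf
    hsum hcompl hEP T hS h𝓚 hle h𝓖ur (fun w ↦ (h𝓖inl w).symm) T₁ hT₁T _ hbig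
  have hsumT₁ : (∑ v ∈ T₁, if v = vp then 2 else 1) = T₀.card + 2 := by
    rw [hT₁, Finset.sum_insert hvpT₀, if_pos rfl,
      Finset.sum_congr rfl fun v (hv : v ∈ T₀) ↦ if_neg (fun h : v = vp ↦ hvpT₀ (h ▸ hv)),
      Finset.sum_const, smul_eq_mul,
      mul_one, add_comm]
  rw [hsumT₁] at hcard
  refine ⟨𝓖.selmerGroup, hfin, hcard, fun y hy ↦ ⟨fun v hv ↦ ?_, fun w ↦ ?_, fun v hv ↦ ?_⟩⟩
  · have hv' : v ∉ T₁ := by rwa [hT₁, ← Finset.mem_coe]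
    have h := (𝓖.mem_selmerGroup_iff y).mp hy (Sum.inr v)
    rw [h𝓖off v hv'] at h
    have h' : y ∈ (W.kummerSelmerStructure (p : ℤ) (Sum.inr v)).comap
        (galoisCohomology.localization (W.torsionGaloisModule (p : ℤ)) (Sum.inr v) 1) := h
    rw [comap_localization_kummerSelmerStructure] at h'
    exact h'
  · have h := (𝓖.mem_selmerGroup_iff y).mp hy (Sum.inl w)
    rw [h𝓖inl w] at h
    have h' : y ∈ (W.kummerSelmerStructure (p : ℤ) (Sum.inl w)).comap
        (galoisCohomology.localization (W.torsionGaloisModule (p : ℤ)) (Sum.inl w) 1) := h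
    rw [comap_localization_kummerSelmerStructure] at h'
    exact h'
  · have h := (𝓖.mem_selmerGroup_iff y).mp hy (Sum.inr v)
    rw [h𝓖T₀ v hv] at h
    exact h

end AtP

/-! ## §3. `GeneratorCountGE W p (#S + 2)` -/

section Two

open Summit.BirchSwinnertonDyer.Rank1Residual.X1.GeneratorCountSqueeze
  Summit.BirchSwinnertonDyer.Rank1Residual.X1.GeneratorCountTamagawa

variable {W : WeierstrassCurve ℚ} [W.IsElliptic] [W.IsGloballyMinimal] {p : ℕ} [hp : Fact p.Prime]

/-- **`GeneratorCountGE W p (#S + 2)`**: `p` odd, `p ∤ #E(ℚ)_tors`, the local hypothesis `hloc` of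
FILE 3 §1, `p ∣ c_v` on `S`, and a `ℚ_p`-point of order `p` on `E` ⟹ `X(E/ℚ_∞)` needs at least
`#S + 2` generators for every torsion cyclotomic dual datum — route T's full layer-`0` count
`t₀ + a` at `δ = 0`, `a = 2` (X1R0-GAPMAP §14.1), IN THE KERNEL modulo Poitou–Tate over `ℚ` and
`hloc`. [cite: GreenbergLNM1716, §3 Lemma 3.4 (p. 89), §5 pp. 114–118, p. 137] -/
theorem generatorCountGE_of_dvd_localTamagawaNumber_atP_two (hodd : p ≠ 2)
    (hPT : poitouTate_selmerStructure_duality ℚ) (htors : ¬ p ∣ W.torsionOrder)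
    (hloc : ∀ (κ : ZpExtension ℚ p), κ.IsCyclotomic → ∀ (v : HeightOneSpectrum (𝓞 ℚ)),
      ((p : ℕ) : 𝓞 ℚ) ∈ v.asIdeal → ∀ y : galH1Torsion W (p : ℤ),
      W.layerToInfty κ 0 (resH1Hom (Literature.NumberTheory.EllipticCurves.subgroupIncl (κ.layerSubgroup 0))
          (AddMonoidHom.id (geomPrimaryTorsion W p)) (fun _ _ ↦ rfl) (torsionToPrimaryH1 W p y)) ∈
        W.localKerOver p κ.kerSubgroup (v.adicCompletion ℚ))
    (S : Finset (HeightOneSpectrum (𝓞 ℚ))) (hSp : ∀ v ∈ S, ((p : ℕ) : 𝓞 ℚ) ∉ v.asIdeal)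
    (hcv : ∀ v ∈ S,
      p ∣ (W.baseChange (v.adicCompletion ℚ)).localTamagawaNumber (v.adicCompletionIntegers ℚ))
    (vp : HeightOneSpectrum (𝓞 ℚ)) (hvp : ((p : ℕ) : 𝓞 ℚ) ∈ vp.asIdeal)
    (hPt : ∃ P : (W.baseChange (vp.adicCompletion ℚ)).toAffine.Point, P ≠ 0 ∧ p • P = 0) :
    GeneratorCountGE W p (S.card + 2) := by
  haveI : NeZero p := ⟨hp.out.ne_zero⟩
  obtain ⟨inv, hperf, hsum, -, hcompl⟩ := hPT p
  have hK : ∀ P : W.toAffine.Point, p • P = 0 → P = 0 :=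
    fun P hP ↦ Additive.forall_smul_eq_zero_of_not_dvd_torsionOrder W p htors P (by convert hP)
  have hwit : ∀ v ∈ S, ∃ u ∈ unramifiedSubgroup
      ((W.torsionGaloisModule (p : ℤ)).restrictField (v.adicCompletion ℚ)) 1,
      u ∉ W.kummerLocalConditionAt (p : ℤ) (v.adicCompletion ℚ) := fun v hv ↦ by
    haveI : Finite (IsLocalRing.ResidueField (v.adicCompletionIntegers ℚ)) :=
      HeightOneSpectrum.finite_residueField_adicCompletionIntegers ℚ v
    rcases Additive.hasAdditiveReductionAt_or_hasSplitMultiplicativeReductionAt_of_dvd_localTamagawaNumber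
        W v hodd (hcv v hv) with hadd | hsplit
    · exact Additive.exists_mem_unramifiedSubgroup_not_mem_kummerLocalConditionAt_of_hasAdditiveReductionAt
        W p v (hSp v hv) hodd hadd (hcv v hv)
    · exact Additive.exists_mem_unramifiedSubgroup_not_mem_kummerLocalConditionAt_of_split_of_dvd_localTamagawaNumber
        W v hsplit (hSp v hv) (hcv v hv)
  refine generatorCountGE_of_layerZeroClasses hK fun κ hκ ↦ ?_
  obtain ⟨Sg, hSfin, hcard, hS⟩ :=
    exists_addSubgroup_relaxedKummer_atP_two hodd inv hperf hsum hcompl S hSp hwit vp hvp hPt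
  haveI := hSfin
  obtain ⟨s, hs⟩ := Additive.exists_finset_torsion_selmerInftyPreimage_zero_card_eq W p κ
    (fun P hP ↦ Additive.forall_smul_eq_zero_of_not_dvd_torsionOrder W p htors P (by convert hP)) Sg
    (↑(insert vp S) : Set (HeightOneSpectrum (𝓞 ℚ))) (fun y hy v hv ↦ (hS y hy).1 v hv)
    (fun y hy w ↦ (hS y hy).2.1 w) fun y hy v hv ↦ by
      rcases Finset.mem_insert.mp (Finset.mem_coe.mp hv) with rfl | hv
      · exact hloc κ hκ v hvp y
      · exact Additive.layerToInfty_resH1Hom_torsionToPrimaryH1_mem_localKerOver_of_mem_unramified_sup_kummer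
          W p κ v (hSp v hv) (Additive.exists_apply_resGal_ne_one_of_isCyclotomic κ hκ v (hSp v hv)) y
          ((hS y hy).2.2 v hv)
  exact ⟨s, hs ▸ hcard⟩

end Two

end Summit.BirchSwinnertonDyer.Rank1Residual.X1.GeneratorCountAnomalousTwo

end
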